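import Mathlib.Analysis.SpecialFunctions.Integrals.Basic
import Mathlib.Analysis.Calculus.FDeriv.Measurable
import Mathlib.Analysis.Real.Pi.Bounds
import Literature.Analysis.FluidPDE.ElgindiProfileTail
import HarnessLib

/-!
# The singular angular integral `∫₀^{π/2} |D_θΓ|² sin(2θ)^{−γ} dθ ≤ 10α` of Elgindi
([Elgindi2021] §6.1, proof of Proposition 6.5)

Topic `Literature/Analysis/FluidPDE`. Proof file (everything proved, no definitions, no named
facts) on the proof path of the named fact
`Literature.Analysis.FluidPDE.Elgindi.ElgindiGhoulMasmoudi2021_stabilityCore`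
(`ElgindiStabilityDecomposition.lean`). T. M. Elgindi, Ann. of Math. 194 (2021) =
arXiv:1904.04795 (`[Elgindi2021]`), §6.1, proof of Proposition 6.5 (p. 16 of the held text):

> "Now, it is easy to check that `∫₀^{π/2} sin(2θ)^{−γ}|D_θΓ(θ)|² dθ ≤ ∫₀^{π/2} 4α²Γ²/sin(2θ)^γ ≤
> 4α²∫₀^{π/2} dθ/sin(2θ)^{1−α/2} ≤ 4α²∫₀^{π/2} ((2/π)θ)^{−(1−α/2)} ≤ 10α`."

with `Γ = (sin θcos²θ)^{α/3}`, `D_θ = sin(2θ)∂_θ`, `γ = 1 + α/10` (`Elgindi.angularWeight`,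
`Elgindi.gammaExp`). This is the quantitative form of the finiteness
`lintegral_angularWeight_sq_mul_rpow_lt_top` (`ElgindiProfileTail.lean`), and the constant that
makes the `Γ'`-terms of `D_θ𝓛_Γ^T` perturbative ("this produces a term of size `α`", Remark 6.6).

## The vendored computation (the printed chain with honest exponents)

`|D_θΓ| = (2α/3)|1 − 3sin²θ|Γ ≤ (4α/3)Γ` (`sin_two_mul_mul_deriv_angularWeight`);
`Γ² = (sin θcos²θ)^{2α/3} ≤ sin(2θ)^{2α/3}` (`sin θcos²θ ≤ sin 2θ`); hence the integrand is at most
`(16α²/9) sin(2θ)^{r}`, `r = 2α/3 − γ = −(1 − 17α/30)`; by Jordan's inequality on both halves,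
`sin(2θ)^r ≤ ((4/π)θ)^r + ((4/π)(π/2 − θ))^r` on `(0, π/2)`, and each of the two integrates to
`2^r(π/2)/(r+1) ≤ (π/2)·30/(17α)`; altogether `≤ (16α²/9)(30π/(17α)) = (480π/153)α < 10α`.
(The printed middle exponent `1 − α/2` is not the one these `Γ, γ` give; the printed end bound
`10α` holds.) Proved for `0 < α ≤ 1/200` (only `17α/30 ≤ 1` and `r > −1` are used).
-/

noncomputable section

open MeasureTheory Set Real intervalIntegral

namespace Literature.Analysis.FluidPDE

namespace Elgindi

/-- `sin θ cos²θ ≤ sin(2θ)` on `[0, π/2]`. [folklore] -/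
theorem sin_mul_cos_sq_le_sin_two_mul {θ : ℝ} (hθ : θ ∈ Icc 0 (π / 2)) :
    Real.sin θ * Real.cos θ ^ 2 ≤ Real.sin (2 * θ) := by
  rw [Real.sin_two_mul]
  have hs : 0 ≤ Real.sin θ := Real.sin_nonneg_of_nonneg_of_le_pi hθ.1 (by linarith [hθ.2, pi_pos])
  have hc : 0 ≤ Real.cos θ := Real.cos_nonneg_of_mem_Icc ⟨by linarith [hθ.1, pi_pos], hθ.2⟩
  have hc1 : Real.cos θ ≤ 1 := Real.cos_le_one θ
  nlinarith [mul_nonneg hs hc]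

/-- **Pointwise majorant**: on `(0, π/2)`,
`(sin(2θ)Γ'(θ))² sin(2θ)^{−γ} ≤ (16α²/9)·(((4/π)θ)^r + ((4/π)(π/2 − θ))^r)`, `r = 2α/3 − γ`
(`0 ≤ α ≤ 1`). [cite: Elgindi2021, §6.1, proof of Proposition 6.5 (p. 16 of arXiv:1904.04795)] -/
theorem sq_Dθ_angularWeight_mul_rpow_le {α : ℝ} (hα : 0 ≤ α) (hα1 : α ≤ 1) {θ : ℝ}
    (hθ : θ ∈ Ioo 0 (π / 2)) :
    (Real.sin (2 * θ) * deriv (angularWeight α) θ) ^ 2 * Real.sin (2 * θ) ^ (-gammaExp α) ≤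
      16 * α ^ 2 / 9 * ((4 / π * θ) ^ (2 * α / 3 - gammaExp α) +
        (4 / π * (π / 2 - θ)) ^ (2 * α / 3 - gammaExp α)) := by
  set r : ℝ := 2 * α / 3 - gammaExp α with hr
  have hr0 : r ≤ 0 := by simp only [hr, gammaExp]; linarith
  set s : ℝ := Real.sin (2 * θ) with hs
  have hspos : 0 < s := Real.sin_pos_of_pos_of_lt_pi (by linarith [hθ.1]) (by linarith [hθ.2])
  have hθ' : θ ∈ Icc 0 (π / 2) := Ioo_subset_Icc_self hθ
  set x : ℝ := Real.sin θ * Real.cos θ ^ 2 with hx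
  have hx0 : 0 ≤ x := sin_mul_cos_sq_nonneg hθ'
  have hxs : x ≤ s := sin_mul_cos_sq_le_sin_two_mul hθ'
  have hΓ0 : 0 ≤ angularWeight α θ := angularWeight_nonneg α hθ'
  -- `(sin 2θ Γ')² ≤ (16α²/9) Γ²`
  have h1 : (Real.sin (2 * θ) * deriv (angularWeight α) θ) ^ 2 ≤ 16 * α ^ 2 / 9 * angularWeight α θ ^ 2 := by
    rw [sin_two_mul_mul_deriv_angularWeight α hθ]
    have hb : (1 - 3 * Real.sin θ ^ 2) ^ 2 ≤ 4 := by
      have hs1 : Real.sin θ ^ 2 ≤ 1 := by nlinarith [Real.sin_sq_le_one θ]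
      nlinarith [sq_nonneg (Real.sin θ)]
    have : (2 * α / 3 * (1 - 3 * Real.sin θ ^ 2) * angularWeight α θ) ^ 2 =
        (4 * α ^ 2 / 9) * (1 - 3 * Real.sin θ ^ 2) ^ 2 * angularWeight α θ ^ 2 := by ring
    rw [this]
    have hA : 0 ≤ 4 * α ^ 2 / 9 * angularWeight α θ ^ 2 := by positivity
    nlinarith
  -- `Γ² sin(2θ)^{−γ} ≤ s^{2α/3} s^{−γ} = s^r`
  have h2 : angularWeight α θ ^ 2 ≤ s ^ (2 * α / 3) := by
    have e : angularWeight α θ ^ 2 = x ^ (2 * α / 3) := by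
      rw [hx]
      unfold angularWeight
      rw [← Real.rpow_two, ← Real.rpow_mul (sin_mul_cos_sq_nonneg hθ')]
      ring_nf
    rw [e]
    exact Real.rpow_le_rpow hx0 hxs (by positivity)
  have h3 : s ^ (2 * α / 3) * s ^ (-gammaExp α) = s ^ r := by
    rw [← Real.rpow_add hspos, hr]
    ring_nf
  -- Jordan on both halves: `s^r ≤ ((4/π)θ)^r + ((4/π)(π/2−θ))^r`
  have hJ : s ^ r ≤ (4 / π * θ) ^ r + (4 / π * (π / 2 - θ)) ^ r := by
    have n1 : 0 ≤ (4 / π * θ) ^ r := Real.rpow_nonneg (by have := hθ.1; positivity) _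
    have n2 : 0 ≤ (4 / π * (π / 2 - θ)) ^ r := Real.rpow_nonneg (by
      have : 0 < π / 2 - θ := by linarith [hθ.2]
      positivity) _
    rcases le_or_gt θ (π / 4) with hle | hgt
    · -- `sin 2θ ≥ (2/π)(2θ)`
      have hj : 2 / π * (2 * θ) ≤ Real.sin (2 * θ) :=
        Real.mul_le_sin (by linarith [hθ.1]) (by linarith)
      have hpos : 0 < 4 / π * θ := by have := hθ.1; positivity
      have : s ^ r ≤ (4 / π * θ) ^ r :=
        Real.rpow_le_rpow_of_nonpos hpos (by rw [hs]; convert hj using 1; ring) hr0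
      linarith
    · -- `sin 2θ = sin(π − 2θ) ≥ (2/π)(π − 2θ)`
      have hj : 2 / π * (π - 2 * θ) ≤ Real.sin (π - 2 * θ) :=
        Real.mul_le_sin (by linarith [hθ.2]) (by linarith)
      rw [Real.sin_pi_sub] at hj
      have hpos : 0 < 4 / π * (π / 2 - θ) := by
        have : 0 < π / 2 - θ := by linarith [hθ.2]
        positivity
      have : s ^ r ≤ (4 / π * (π / 2 - θ)) ^ r :=
        Real.rpow_le_rpow_of_nonpos hpos (by rw [hs]; convert hj using 1; ring) hr0
      linarith
  -- assemble
  have hsγ : 0 ≤ s ^ (-gammaExp α) := Real.rpow_nonneg hspos.le _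
  calc (Real.sin (2 * θ) * deriv (angularWeight α) θ) ^ 2 * Real.sin (2 * θ) ^ (-gammaExp α)
      ≤ (16 * α ^ 2 / 9 * angularWeight α θ ^ 2) * s ^ (-gammaExp α) :=
        mul_le_mul_of_nonneg_right h1 hsγ
    _ ≤ (16 * α ^ 2 / 9 * s ^ (2 * α / 3)) * s ^ (-gammaExp α) := by
        apply mul_le_mul_of_nonneg_right _ hsγ
        exact mul_le_mul_of_nonneg_left h2 (by positivity)
    _ = 16 * α ^ 2 / 9 * s ^ r := by rw [mul_assoc, h3]
    _ ≤ 16 * α ^ 2 / 9 * ((4 / π * θ) ^ r + (4 / π * (π / 2 - θ)) ^ r) :=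
        mul_le_mul_of_nonneg_left hJ (by positivity)

/-- `∫₀^{π/2} ((4/π)θ)^r dθ = 2^r(π/2)/(r+1)` for `r > −1`. [folklore] -/
theorem integral_const_mul_rpow {r : ℝ} (hr : -1 < r) :
    ∫ θ in (0 : ℝ)..(π / 2), (4 / π * θ) ^ r = 2 ^ r * (π / 2) / (r + 1) := by
  have hr1 : r + 1 ≠ 0 := by linarith
  have e : ∀ θ ∈ uIcc (0 : ℝ) (π / 2), (4 / π * θ) ^ r = (4 / π) ^ r * θ ^ r := by
    intro θ hθ
    rw [uIcc_of_le (by positivity)] at hθ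
    exact Real.mul_rpow (by positivity) hθ.1
  rw [intervalIntegral.integral_congr e, intervalIntegral.integral_const_mul, integral_rpow (Or.inl hr),
    Real.zero_rpow hr1, sub_zero, Real.rpow_add_one (by positivity : (π / 2 : ℝ) ≠ 0)]
  have h2 : (4 / π : ℝ) ^ r * (π / 2) ^ r = 2 ^ r := by
    rw [← Real.mul_rpow (by positivity) (by positivity)]
    congr 1
    field_simp
    ring
  calc (4 / π) ^ r * ((π / 2) ^ r * (π / 2) / (r + 1)) = (4 / π) ^ r * (π / 2) ^ r * (π / 2) / (r + 1) := by
        ring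
    _ = 2 ^ r * (π / 2) / (r + 1) := by rw [h2]

/-- The mirrored integral `∫₀^{π/2} ((4/π)(π/2 − θ))^r dθ` has the same value. [folklore] -/
theorem integral_const_mul_sub_rpow {r : ℝ} (hr : -1 < r) :
    ∫ θ in (0 : ℝ)..(π / 2), (4 / π * (π / 2 - θ)) ^ r = 2 ^ r * (π / 2) / (r + 1) := by
  have h := intervalIntegral.integral_comp_sub_left (fun θ : ℝ => (4 / π * θ) ^ r) (a := 0)
    (b := π / 2) (π / 2)
  simp only [sub_self, sub_zero] at h
  rw [h, integral_const_mul_rpow hr]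

/-- The two majorants are integrable on `(0, π/2)`. [folklore] -/
theorem integrableOn_const_mul_rpow {r : ℝ} (hr : -1 < r) :
    IntegrableOn (fun θ : ℝ => (4 / π * θ) ^ r) (Ioo 0 (π / 2)) := by
  have h := (intervalIntegral.intervalIntegrable_rpow' hr (a := 0) (b := π / 2)).const_mul ((4 / π) ^ r)
  rw [intervalIntegrable_iff_integrableOn_Ioc_of_le (by positivity)] at h
  refine (h.mono_set Ioo_subset_Ioc_self).congr_fun (fun θ hθ => ?_) measurableSet_Ioo
  exact (Real.mul_rpow (by positivity) hθ.1.le).symm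

/-- The mirrored majorant is integrable on `(0, π/2)`. [folklore] -/
theorem integrableOn_const_mul_sub_rpow {r : ℝ} (hr : -1 < r) :
    IntegrableOn (fun θ : ℝ => (4 / π * (π / 2 - θ)) ^ r) (Ioo 0 (π / 2)) := by
  have h0 : IntervalIntegrable (fun θ : ℝ => (4 / π * θ) ^ r) volume 0 (π / 2) := by
    have h := (intervalIntegral.intervalIntegrable_rpow' hr (a := 0) (b := π / 2)).const_mul ((4 / π) ^ r)
    refine h.congr fun θ hθ => ?_
    rw [uIoc_of_le (by positivity)] at hθ
    exact (Real.mul_rpow (by positivity) hθ.1.le).symm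
  have h := h0.comp_sub_left (π / 2)
  simp only [sub_self, sub_zero] at h
  have h' := h.symm
  rw [intervalIntegrable_iff_integrableOn_Ioc_of_le (by positivity)] at h'
  exact h'.mono_set Ioo_subset_Ioc_self

/-- The singular angular integrand `(sin(2θ)Γ')² sin(2θ)^{−γ}` is integrable on `(0, π/2)`
(`0 < α ≤ 1`; dominated by the majorant of `sq_Dθ_angularWeight_mul_rpow_le`). [folklore] -/
theorem integrableOn_sq_Dθ_angularWeight_mul_rpow {α : ℝ} (hα : 0 < α) (hα1 : α ≤ 1) :
    IntegrableOn (fun θ => (Real.sin (2 * θ) * deriv (angularWeight α) θ) ^ 2 *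
        Real.sin (2 * θ) ^ (-gammaExp α)) (Ioo 0 (π / 2)) := by
  set r : ℝ := 2 * α / 3 - gammaExp α with hr
  have hr1 : -1 < r := by simp only [hr, gammaExp]; linarith
  set M : ℝ → ℝ := fun θ => 16 * α ^ 2 / 9 * ((4 / π * θ) ^ r + (4 / π * (π / 2 - θ)) ^ r) with hM
  have iM : IntegrableOn M (Ioo 0 (π / 2)) :=
    ((integrableOn_const_mul_rpow hr1).add (integrableOn_const_mul_sub_rpow hr1)).const_mul _
  have hm : Measurable fun θ => (Real.sin (2 * θ) * deriv (angularWeight α) θ) ^ 2 *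
      Real.sin (2 * θ) ^ (-gammaExp α) := by
    have h1 : Measurable fun θ : ℝ => Real.sin (2 * θ) := by fun_prop
    have h2 : Measurable (deriv (angularWeight α)) := measurable_deriv _
    exact ((h1.mul h2).pow_const 2).mul (h1.pow_const _)
  refine Integrable.mono' iM hm.aestronglyMeasurable ?_
  rw [ae_restrict_iff' measurableSet_Ioo]
  refine Filter.Eventually.of_forall fun θ hθ => ?_
  have hs : 0 < Real.sin (2 * θ) := Real.sin_pos_of_pos_of_lt_pi (by linarith [hθ.1]) (by linarith [hθ.2])
  rw [Real.norm_eq_abs, abs_of_nonneg (mul_nonneg (sq_nonneg _) (Real.rpow_nonneg hs.le _))]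
  exact sq_Dθ_angularWeight_mul_rpow_le hα.le hα1 hθ

/-- **`∫₀^{π/2} |D_θΓ|² sin(2θ)^{−γ} dθ ≤ 10α`** for `0 < α ≤ 1/200` (Elgindi 2021, proof of
Proposition 6.5: "it is easy to check that `∫₀^{π/2} sin(2θ)^{−γ}|D_θΓ(θ)|²dθ ≤ … ≤ 10α`"), with
`D_θΓ = sin(2θ)Γ'`, `γ = 1 + α/10`. See the module docstring for the chain of inequalities. [cite: Elgindi2021, §6.1, proof of Proposition 6.5 (p. 16 of arXiv:1904.04795)] -/
theorem integral_sq_Dθ_angularWeight_mul_rpow_le {α : ℝ} (hα : 0 < α) (hα' : α ≤ 1 / 200) :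
    ∫ θ in Ioo 0 (π / 2), (Real.sin (2 * θ) * deriv (angularWeight α) θ) ^ 2 *
        Real.sin (2 * θ) ^ (-gammaExp α) ≤ 10 * α := by
  set r : ℝ := 2 * α / 3 - gammaExp α with hr
  have hr1 : -1 < r := by simp only [hr, gammaExp]; linarith
  have hr0 : r ≤ 0 := by simp only [hr, gammaExp]; linarith
  have hre : r + 1 = 17 * α / 30 := by simp only [hr, gammaExp]; ring
  set M : ℝ → ℝ := fun θ => 16 * α ^ 2 / 9 * ((4 / π * θ) ^ r + (4 / π * (π / 2 - θ)) ^ r) with hM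
  have iM : IntegrableOn M (Ioo 0 (π / 2)) :=
    ((integrableOn_const_mul_rpow hr1).add (integrableOn_const_mul_sub_rpow hr1)).const_mul _
  -- the integrand is measurable, nonnegative and dominated by `M`
  set Φ : ℝ → ℝ := fun θ => (Real.sin (2 * θ) * deriv (angularWeight α) θ) ^ 2 *
    Real.sin (2 * θ) ^ (-gammaExp α) with hΦ
  have hΦm : AEStronglyMeasurable Φ (volume.restrict (Ioo 0 (π / 2))) := by
    have hm : Measurable Φ := by
      have h1 : Measurable fun θ : ℝ => Real.sin (2 * θ) := by fun_prop
      have h2 : Measurable (deriv (angularWeight α)) := measurable_deriv _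
      exact ((h1.mul h2).pow_const 2).mul (h1.pow_const _)
    exact hm.aestronglyMeasurable
  have hΦ0 : ∀ θ ∈ Ioo 0 (π / 2), 0 ≤ Φ θ := by
    intro θ hθ
    have hs : 0 < Real.sin (2 * θ) := Real.sin_pos_of_pos_of_lt_pi (by linarith [hθ.1]) (by linarith [hθ.2])
    simp only [hΦ]
    exact mul_nonneg (sq_nonneg _) (Real.rpow_nonneg hs.le _)
  have hdom : ∀ θ ∈ Ioo 0 (π / 2), Φ θ ≤ M θ := fun θ hθ =>
    sq_Dθ_angularWeight_mul_rpow_le hα.le (by linarith) hθ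
  have iΦ : IntegrableOn Φ (Ioo 0 (π / 2)) := by
    refine Integrable.mono' iM hΦm ?_
    rw [ae_restrict_iff' measurableSet_Ioo]
    refine Filter.Eventually.of_forall fun θ hθ => ?_
    rw [Real.norm_eq_abs, abs_of_nonneg (hΦ0 θ hθ)]
    exact hdom θ hθ
  -- integrate the majorant
  have hIM : ∫ θ in Ioo 0 (π / 2), M θ = 16 * α ^ 2 / 9 * (2 * (2 ^ r * (π / 2) / (r + 1))) := by
    simp only [hM]
    rw [MeasureTheory.integral_const_mul, integral_add (integrableOn_const_mul_rpow hr1)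
      (integrableOn_const_mul_sub_rpow hr1), ← integral_Ioc_eq_integral_Ioo,
      ← intervalIntegral.integral_of_le (by positivity), integral_const_mul_rpow hr1,
      ← integral_Ioc_eq_integral_Ioo, ← intervalIntegral.integral_of_le (by positivity),
      integral_const_mul_sub_rpow hr1]
    ring
  have h2r : (2 : ℝ) ^ r ≤ 1 := Real.rpow_le_one_of_one_le_of_nonpos (by norm_num) hr0
  have hεpos : 0 < r + 1 := by linarith
  calc ∫ θ in Ioo 0 (π / 2), Φ θ ≤ ∫ θ in Ioo 0 (π / 2), M θ :=
        setIntegral_mono_on iΦ iM measurableSet_Ioo hdom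
    _ = 16 * α ^ 2 / 9 * (2 * (2 ^ r * (π / 2) / (r + 1))) := hIM
    _ ≤ 16 * α ^ 2 / 9 * (2 * (1 * (π / 2) / (r + 1))) := by
        gcongr
    _ = 16 * α ^ 2 / 9 * (π / (17 * α / 30)) := by rw [hre]; ring
    _ = (480 * π / 153) * α := by field_simp; ring
    _ ≤ 10 * α := by
        have hπ := Real.pi_lt_d2
        nlinarith

end Elgindi

end Literature.Analysis.FluidPDE
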